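import Summits.Ventures.Crystal3D.Theorems.StickyWulffConstantGenericWallFloorStackWalkRigidity
import Summits.Ventures.Crystal3D.Theorems.StickyWulffConstantCoaxialWallLawReflectionWordsFrame
import Summits.Ventures.Crystal3D.Theorems.StickyWulffConstantCoaxialWallLawStdCases8
import HarnessLib

/-!
# The column word lemma, II: letters, free reduction and the SCATTERED-SUBWORD lemma (input (I5) = (P3)/(L4) of the terrace
# census, cf-p1 RULINGS (ccxxxv)(iii), (ccxli); lane T `TexShadow`, registered stub `stub_terraceCensus`, crux `TextureLiminfV5`)

HONEST FRAMING. Venture `Summits/Ventures/Crystal3D` (cell `crystal3d-full`), route `route-Ventures-StickyWulffConstant`, helper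
`--supports` the law-v5 crux `TextureLiminfV5` (stmt-Ventures-23912), lane T, mechanism (β); owner of input (I5) `stub_columnWord`:
19480-p2 g15.  PURE WORD COMBINATORICS over the tree's reduced-word theory `ReflWord` (…CoaxialWallLawReflectionWords{,NormalForm,Frame}:
letters `Fin 4`, `letterIso`, `wordIso`, free reduction `reduce`/`push`) plus the frame bookkeeping of a chain of twin steps
(`twinFrame`, …StackWalkDefs/Rigidity).  Census-free, standard axioms, clean import closure (RULING (ccxxxix) probe); F-C1 not moved.

THE POINT.  A saturated column crossing coherent twin planes one after the other carries frames `A 0, A 1, …` with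
`A (ℓ+1) = twinFrame (A ℓ) (n ℓ)`, the crossed plane's unit normal `n ℓ` being a MENU normal of `A ℓ`, i.e. `± A ℓ (nrmVec (i ℓ))` for a
LETTER `i ℓ : Fin 4` (`exists_letters`, from `ReflWord.exists_nrmVec_of_menu`).  The COLUMN WORD after `m` steps is the letter list
`((List.range m).map i).reverse` (most recent letter first, the convention of `wordIso` / `wordFrame` / …StackNoReturn), and
* `frame_eq_wordIso_trans` — `A m = (wordIso ((List.range m).map i).reverse).trans (A 0)`; with `ReflWord.wordIso_reduce` the frame only sees the
  FREE REDUCTION of the column word, so the spatial normal of every crossing is determined by the REDUCED PREFIX (`normal_eq_of_reduce`);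
* `exists_split_of_reduce_eq` — **SCATTERED SUBWORD** (pure list lemma): if `reduce w = κ₂ ++ a :: κ₁` then `w = w₂ ++ a :: w₁` with
  `reduce w₁ = κ₁` — every letter of the normal form IS a letter of the word, met with exactly the reduced prefix before it;
* `exists_index_of_reduce_eq` — the indexed form for column words: a step `ℓ < m` with `i ℓ = a` and `reduce (column word at ℓ) = κ₁`;
* `exists_positions_of_reduce_eq` — **IN ORDER**: if the column word reduces to `κ`, there are steps `p 0 > p 1 > … > p (|κ|−1)` (most recent
  letter first) with `i (p j) = κ[j]` and reduced prefix `κ.drop (j+1)` at step `p j` — the letters of `κ` are realised in crossing order, all other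
  crossings being organised in cancelling pairs (complete twin bands).
WHAT THIS IS NOT: the affine half (…ColumnWordAffine), the plate-matching column theorem (…ColumnWord) or the (I5) Def; F-C1 not moved.
-/

noncomputable section

namespace Summit.Ventures.Crystal3D.Theorems

namespace ColumnWord

open Summit.Ventures.Crystal3D ReflWord
open scoped InnerProductSpace

/-! ### Free reduction: the scattered-subword lemma -/

/-- **SCATTERED SUBWORD.**  If the normal form of `w` splits as `κ₂ ++ a :: κ₁`, then `w` itself splits as `w₂ ++ a :: w₁` with
`reduce w₁ = κ₁`: the letter `a` of the normal form occurs in `w`, preceded (in `w`) by a suffix whose normal form is exactly `κ₁`. -/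
theorem exists_split_of_reduce_eq : ∀ (w κ₂ : List (Fin 4)) {a : Fin 4} {κ₁ : List (Fin 4)},
    reduce w = κ₂ ++ a :: κ₁ → ∃ w₂ w₁ : List (Fin 4), w = w₂ ++ a :: w₁ ∧ reduce w₁ = κ₁
  | [], κ₂, a, κ₁, h => by simp at h
  | c :: w, κ₂, a, κ₁, h => by
    rw [reduce_cons] at h
    rcases hr : reduce w with _ | ⟨b, t⟩
    · rw [hr] at h
      change [c] = κ₂ ++ a :: κ₁ at h
      rcases κ₂ with _ | ⟨x, κ₂'⟩
      · simp only [List.nil_append, List.cons.injEq] at h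
        obtain ⟨rfl, h'⟩ := h
        exact ⟨[], w, by simp, by rw [hr, ← h']⟩
      · simp at h
    · rw [hr] at h
      by_cases hcb : c = b
      · subst hcb
        have ht : t = κ₂ ++ a :: κ₁ := by simpa [push] using h
        obtain ⟨w₂, w₁, hw, hw₁⟩ := exists_split_of_reduce_eq w (c :: κ₂) (a := a) (κ₁ := κ₁) (by rw [hr, ht]; rfl)
        exact ⟨c :: w₂, w₁, by rw [hw]; rfl, hw₁⟩
      · have h' : c :: b :: t = κ₂ ++ a :: κ₁ := by simpa [push, hcb] using h
        rcases κ₂ with _ | ⟨x, κ₂'⟩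
        · simp only [List.nil_append, List.cons.injEq] at h'
          obtain ⟨rfl, hbt⟩ := h'
          exact ⟨[], w, by simp, by rw [hr, hbt]⟩
        · simp only [List.cons_append, List.cons.injEq] at h'
          obtain ⟨rfl, hbt⟩ := h'
          obtain ⟨w₂, w₁, hw, hw₁⟩ := exists_split_of_reduce_eq w κ₂' (a := a) (κ₁ := κ₁) (by rw [hr, hbt])
          exact ⟨c :: w₂, w₁, by rw [hw]; rfl, hw₁⟩

/-! ### Column words `((List.range m).map i).reverse` -/

/-- One more step prepends the newest letter. -/
theorem colWord_succ (i : ℕ → Fin 4) (m : ℕ) :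
    ((List.range (m + 1)).map i).reverse = i m :: ((List.range m).map i).reverse := by
  rw [List.range_succ, List.map_append, List.reverse_append]; rfl

/-- The column word has length `m`. -/
theorem length_colWord (i : ℕ → Fin 4) (m : ℕ) : (((List.range m).map i).reverse).length = m := by
  simp

/-- **Scattered subword, indexed form.**  If the column word after `m` steps reduces to `κ₂ ++ a :: κ₁`, some step `ℓ < m` carries the
letter `a` with reduced prefix exactly `κ₁`. -/
theorem exists_index_of_reduce_eq (i : ℕ → Fin 4) :
    ∀ (m : ℕ) (κ₂ : List (Fin 4)) {a : Fin 4} {κ₁ : List (Fin 4)},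
      reduce ((List.range m).map i).reverse = κ₂ ++ a :: κ₁ →
        ∃ ℓ, ℓ < m ∧ i ℓ = a ∧ reduce ((List.range ℓ).map i).reverse = κ₁
  | 0, κ₂, a, κ₁, h => by simp at h
  | m + 1, κ₂, a, κ₁, h => by
    rw [colWord_succ, reduce_cons] at h
    rcases hr : reduce ((List.range m).map i).reverse with _ | ⟨b, t⟩
    · rw [hr] at h
      change [i m] = κ₂ ++ a :: κ₁ at h
      rcases κ₂ with _ | ⟨x, κ₂'⟩
      · simp only [List.nil_append, List.cons.injEq] at h
        obtain ⟨hia, h'⟩ := h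
        exact ⟨m, Nat.lt_succ_self m, hia, by rw [hr, ← h']⟩
      · simp at h
    · rw [hr] at h
      by_cases hcb : i m = b
      · have ht : t = κ₂ ++ a :: κ₁ := by simpa [push, hcb] using h
        obtain ⟨ℓ, hℓ, hia, hred⟩ := exists_index_of_reduce_eq i m (b :: κ₂) (a := a) (κ₁ := κ₁) (by rw [hr, ht]; rfl)
        exact ⟨ℓ, Nat.lt_succ_of_lt hℓ, hia, hred⟩
      · have h' : i m :: b :: t = κ₂ ++ a :: κ₁ := by simpa [push, hcb] using h
        rcases κ₂ with _ | ⟨x, κ₂'⟩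
        · simp only [List.nil_append, List.cons.injEq] at h'
          obtain ⟨hia, hbt⟩ := h'
          exact ⟨m, Nat.lt_succ_self m, hia, by rw [hr, hbt]⟩
        · simp only [List.cons_append, List.cons.injEq] at h'
          obtain ⟨-, hbt⟩ := h'
          obtain ⟨ℓ, hℓ, hia, hred⟩ := exists_index_of_reduce_eq i m κ₂' (a := a) (κ₁ := κ₁) (by rw [hr, hbt])
          exact ⟨ℓ, Nat.lt_succ_of_lt hℓ, hia, hred⟩

/-- **THE LETTERS OF THE NORMAL FORM ARE REALISED IN ORDER.**  If the column word after `m` steps reduces to `κ` (most recent letter first),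
there are steps `p 0 > p 1 > ⋯ > p (|κ| − 1)`, all `< m`, such that step `p j` carries the letter `κ[j]` (stated as
`κ.drop j = i (p j) :: κ.drop (j+1)`) with reduced prefix `κ.drop (j+1)`. -/
theorem exists_positions_of_reduce_eq (i : ℕ → Fin 4) :
    ∀ (κ : List (Fin 4)) (m : ℕ), reduce ((List.range m).map i).reverse = κ →
      ∃ p : ℕ → ℕ,
        (∀ j < κ.length, p j < m ∧ κ.drop j = i (p j) :: κ.drop (j + 1) ∧
          reduce ((List.range (p j)).map i).reverse = κ.drop (j + 1)) ∧
        ∀ j j', j < j' → j' < κ.length → p j' < p j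
  | [], m, _ => ⟨fun _ => 0, fun j hj => absurd hj (Nat.not_lt_zero j), fun j j' _ hj' => absurd hj' (Nat.not_lt_zero j')⟩
  | a :: κ₁, m, h => by
    obtain ⟨ℓ, hℓm, hia, hred⟩ := exists_index_of_reduce_eq i m [] (a := a) (κ₁ := κ₁) (by rw [h]; rfl)
    obtain ⟨p₁, hp₁, hmono₁⟩ := exists_positions_of_reduce_eq i κ₁ ℓ hred
    refine ⟨fun j => if j = 0 then ℓ else p₁ (j - 1), fun j hj => ?_, fun j j' hjj' hj' => ?_⟩
    · rcases j with _ | j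
      · exact ⟨by simpa using hℓm, by simp [hia], by simpa using hred⟩
      · have hj₁ : j < κ₁.length := by simpa using hj
        obtain ⟨h1, h2, h3⟩ := hp₁ j hj₁
        refine ⟨?_, ?_, ?_⟩
        · simpa using h1.trans hℓm
        · simpa using h2
        · simpa using h3
    · rcases j' with _ | j'
      · exact absurd hjj' (Nat.not_lt_zero j)
      have hj₁' : j' < κ₁.length := by simpa using hj'
      rcases j with _ | j
      · simpa using (hp₁ j' hj₁').1
      · have hjj : j < j' := by omega
        simpa using hmono₁ j j' hjj hj₁'

/-! ### Letters and frames of a chain of twin steps -/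

/-- **MENU NORMALS ARE LETTERS, step by step.**  Along a chain whose crossed normals `n ℓ` are unit menu normals of the frames `A ℓ`
(`ℓ < m`), there is a letter sequence `i` with `n ℓ = ± A ℓ (nrmVec (i ℓ))`. -/
theorem exists_letters {A : ℕ → (EuclideanSpace ℝ (Fin 3) ≃ₗᵢ[ℝ] EuclideanSpace ℝ (Fin 3))} {n : ℕ → EuclideanSpace ℝ (Fin 3)}
    {m : ℕ} (hmenu : ∀ ℓ < m, ‖n ℓ‖ = 1 ∧
      ∀ w ∈ fccSlots, ⟪A ℓ w, n ℓ⟫_ℝ = 0 ∨ ⟪A ℓ w, n ℓ⟫_ℝ = Real.sqrt (2 / 3) ∨ ⟪A ℓ w, n ℓ⟫_ℝ = -Real.sqrt (2 / 3)) :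
    ∃ i : ℕ → Fin 4, ∀ ℓ < m, n ℓ = A ℓ (nrmVec (i ℓ)) ∨ n ℓ = -A ℓ (nrmVec (i ℓ)) := by
  have key : ∀ ℓ, ℓ < m → ∃ i : Fin 4, n ℓ = A ℓ (nrmVec i) ∨ n ℓ = -A ℓ (nrmVec i) := by
    intro ℓ hℓ
    obtain ⟨h1, h2⟩ := hmenu ℓ hℓ
    have hμ1 : ‖(A ℓ).symm (n ℓ)‖ = 1 := by rw [LinearIsometryEquiv.norm_map, h1]
    have hμ2 : ∀ w ∈ fccSlots, ⟪w, (A ℓ).symm (n ℓ)⟫_ℝ = 0 ∨ ⟪w, (A ℓ).symm (n ℓ)⟫_ℝ = Real.sqrt (2 / 3) ∨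
        ⟪w, (A ℓ).symm (n ℓ)⟫_ℝ = -Real.sqrt (2 / 3) := by
      intro w hw
      rw [← (A ℓ).inner_map_map w, LinearIsometryEquiv.apply_symm_apply]
      exact h2 w hw
    obtain ⟨i, hi⟩ := exists_nrmVec_of_menu hμ1 hμ2
    refine ⟨i, ?_⟩
    rcases hi with hi | hi
    · left; rw [← hi, LinearIsometryEquiv.apply_symm_apply]
    · right; rw [← map_neg, ← hi, LinearIsometryEquiv.apply_symm_apply]
  choose! i hi using key
  exact ⟨i, hi⟩

/-- **THE FRAME OF A COLUMN IS THE WORD ISOMETRY OF ITS LETTERS followed by the initial frame**: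
`A m = (wordIso ((List.range m).map i).reverse).trans (A 0)`. -/
theorem frame_eq_wordIso_trans {A : ℕ → (EuclideanSpace ℝ (Fin 3) ≃ₗᵢ[ℝ] EuclideanSpace ℝ (Fin 3))}
    {n : ℕ → EuclideanSpace ℝ (Fin 3)} {i : ℕ → Fin 4} :
    ∀ {m : ℕ}, (∀ ℓ < m, A (ℓ + 1) = twinFrame (A ℓ) (n ℓ)) →
      (∀ ℓ < m, n ℓ = A ℓ (nrmVec (i ℓ)) ∨ n ℓ = -A ℓ (nrmVec (i ℓ))) →
        A m = (wordIso ((List.range m).map i).reverse).trans (A 0)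
  | 0, _, _ => by simp
  | m + 1, hstep, hi => by
    have ih := frame_eq_wordIso_trans (m := m) (fun ℓ hℓ => hstep ℓ (Nat.lt_succ_of_lt hℓ))
      (fun ℓ hℓ => hi ℓ (Nat.lt_succ_of_lt hℓ))
    have him := hi m (Nat.lt_succ_self m)
    have hn1 : ‖n m‖ = 1 := by
      rcases him with h | h
      · rw [h, LinearIsometryEquiv.norm_map, norm_nrmVec]
      · rw [h, norm_neg, LinearIsometryEquiv.norm_map, norm_nrmVec]
    have hsymm : (A m).symm (n m) = nrmVec (i m) ∨ (A m).symm (n m) = -nrmVec (i m) := by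
      rcases him with h | h
      · left; rw [h, LinearIsometryEquiv.symm_apply_apply]
      · right; rw [h, ← map_neg, LinearIsometryEquiv.symm_apply_apply]
    rw [hstep m (Nat.lt_succ_self m), twinFrame_eq_reflection_trans (A m) hn1, reflection_eq_letterIso hsymm, ih,
      LinearIsometryEquiv.trans_assoc, ← wordIso_cons, colWord_succ]

/-- **The spatial normal of each crossing is determined by the REDUCED prefix**: for `ℓ < m`,
`n ℓ = ± ((wordIso (reduce (column word at ℓ))).trans (A 0)) (nrmVec (i ℓ))`. -/
theorem normal_eq_of_reduce {A : ℕ → (EuclideanSpace ℝ (Fin 3) ≃ₗᵢ[ℝ] EuclideanSpace ℝ (Fin 3))}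
    {n : ℕ → EuclideanSpace ℝ (Fin 3)} {i : ℕ → Fin 4} {m : ℕ}
    (hstep : ∀ ℓ < m, A (ℓ + 1) = twinFrame (A ℓ) (n ℓ))
    (hi : ∀ ℓ < m, n ℓ = A ℓ (nrmVec (i ℓ)) ∨ n ℓ = -A ℓ (nrmVec (i ℓ))) {ℓ : ℕ} (hℓ : ℓ < m) :
    n ℓ = ((wordIso (reduce ((List.range ℓ).map i).reverse)).trans (A 0)) (nrmVec (i ℓ)) ∨
      n ℓ = -((wordIso (reduce ((List.range ℓ).map i).reverse)).trans (A 0)) (nrmVec (i ℓ)) := by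
  have hA : A ℓ = (wordIso (reduce ((List.range ℓ).map i).reverse)).trans (A 0) := by
    rw [wordIso_reduce]
    exact frame_eq_wordIso_trans (fun k hk => hstep k (hk.trans hℓ)) (fun k hk => hi k (hk.trans hℓ))
  rw [← hA]
  exact hi ℓ hℓ

end ColumnWord

end Summit.Ventures.Crystal3D.Theorems

end
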